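import Summits.QuantumFields.YangMills.Theorems.UnitScaleTiltProp7QTwSectors
import Summits.QuantumFields.YangMills.Theorems.UnitScaleTiltProp7TrueAvgBudgetFlat
import HarnessLib

/-!
# Route `UnitScaleTilt`, crux K1 «MinimiserStabilityRegPr» (stmt-QuantumFields-19200), stub `stub_existenceMinimalOrbit` (EX), LANE II (B4★)∕(QB) —
# THE SECTOR LETTERS OF THE (QB) KNIT: the `M₂(ℂ)` inequality behind (QB)'s factor 2, the sector split of `CURL_HS + DIV_HS` and of the mass at the member,
# the centre's forms at `W` = at `1`, and ★ THE CENTRE'S LEGS IDENTITY `Q (K−n) (τ·1) ĉ = QTw W (τ·1) c + (flat legs)` at `W ∈ 𝔘_k(ε₀)`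

Cell `ym3-torus` (HUMAN RULING D-0037, YM ladder rung R3 — YM₃ on T³ is a rung, NOT d = 4, NOT infinite volume, NOT a mass gap, NOT Clay; the YM gap is NOT proved),
width seat `ym3-torus-px19` (gen 7; the lineage's (QB) pen: ★p1 g19 NAMER WORDS №5∕№10∕№11 «px19 flat + knit; curved `rlegs` = w4-20520»).  THEOREMS ONLY (0 `def`,
0 `sorry`); `--supports stmt-QuantumFields-19200 --as helper`, count-neutral; nothing here claims the stub, the crux or any summit statement.  Part 1∕2 of the knit
(part 2∕2 = `…TrueAvgBudgetOfRLegs`: ★★★`hQB_of_rlegs`).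

THE MECHANISM OF THE KNIT (pointwise, in the Frobenius space `W₂`; [Balaban1985BackgroundPropagators] (3.11), (3.13)–(3.15)).  Split `A = A₁ + i·A₂ + τ·1` into its two `𝔰𝔲(2)`
sectors and its centre (px10 ✓`Prop7QTwSectors.exists_sector_fields`).  The defect `D(c) := Q (K−n) A ĉ − QTw W A c` is `L₁(c) + i·L₂(c) + L_τ(c)` with `L_i(c)` = the CURVED legs of
`A_i` (LEG ✓`Prop7LegLemmaQTw.QTw_apply_eq_trueLinIter_sub_coarseGauge_T3`) and `L_τ(c)` = the FLAT legs of `τ·1` (§2 ★`central_legs_identity_of_regPr`: the centre does not see the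
background — px10 ✓`trueLinIter_smul_one_eq_flat_of_regPr` ⊕ ✓`QTw_smul_one_eq_QTw_one_of_regPr` ⊕ px21 ✓`QTw_one_apply` at the flat `linAvg` tower ✓`trueLinStep_one_eq_linAvg`); then
`|Q A ĉ|² ≤ ‖Q A ĉ‖²_F ≤ 2‖QTw W A c‖²_F + 2‖D(c)‖²_F` (§1 `norm_sq_le_of_sectors`: the displayed factor `2` is the parallelogram law in `W₂`, no orthogonality of the values of `QTw` is
used) and the right sides of the three legs rows re-assemble into (QB)'s `CURL_HS(W,A) + DIV_HS(W,A)` (§2 `curlHS_divHS_sectors`, EXACT, px10 ✓`sum_normSq_curl_entries_sectors_member`∕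
`…divB…`; `curlHS_divHS_smul_one_bg`, px10 ✓`curl_smul_one_eq`∕`divB_smul_one_eq`) and `Σ_b‖A b‖²` (§1 `sector_normSq_le_two_mul`, px10 ✓`sum_normSq_entries_sectors`).

WHAT IS PROVED (ns `…Theorems.Prop7TrueAvgBudgetSectorLetters`):
* §1 `norm_sq_le_of_sectors` (`q = t + (l₁ + i·l₂ + l₃) ⇒ |q|² ≤ 2‖t‖²_F + 12(|l₁|² + |l₂|² + |l₃|²)`), `sector_normSq_le_two_mul` (`|a₁|² + |a₂|² + |s·1|² ≤ 2|a₁ + i·a₂ + s·1|²`);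
* §2 `curlHS_divHS_sectors`, `curlHS_divHS_smul_one_bg`, ★`central_legs_identity_of_regPr`.
HONEST SCOPE.  Letters; nothing of (QB) at a curved `W`, (ENG), (REC), `hN06`, EX or the crux is proved here; nothing continuum ∕ OS ∕ mass-gap ∕ Clay.

References: T. Bałaban, CMP **99** (1985) 389–434 [Balaban1985BackgroundPropagators] ((3.4) p.391, (3.8)–(3.11) p.392, (3.13)–(3.15) p.393); CMP **98** (1985) 17–51
[Balaban1985Averaging] ((125)–(127) pp.36–37, (160) p.42, (18)–(20) p.21); CMP **95** (1984) 17–40 [Balaban1984PropagatorsI] ((1.18)–(1.21) pp.19–21); CMP **102** (1985) 277–309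
[Balaban1985Variational] ((44) p.285, (51) p.286).
-/

set_option autoImplicit false

noncomputable section

open scoped BigOperators Matrix.Norms.L2Operator Matrix

namespace Summit.QuantumFields.YangMills.Theorems.Prop7TrueAvgBudgetSectorLetters

open Literature.MathematicalPhysics.QuantumFieldTheory.Balaban1983to89
open Literature.MathematicalPhysics.QuantumFieldTheory.Balaban1983to89.T3ContinuumYM3Torus
open Literature.MathematicalPhysics.QuantumFieldTheory.Balaban1983to89.T3PrintedRegularMinimiser (RegPr)
open Finset T4Continuum BlockAveraging AveragingRT ExpMeanLog BlockAveragingEMLLinearised BlockAveragingEMLLinearisedBackground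
open T3LevelShift (bondShift)
open T3PrintedRegularOrbits (sites_eq)
open B9Eq39Adjoint (curl divB)
open B10Eq27TorusAxialLog (unitsField toUField transl)
open B9TorusCalculus (torusT)
open B7Prop3Flat (Fhat)
open B7Prop4Flat (linQIter)
open Literature.MathematicalPhysics.QuantumFieldTheory.Balaban1983to89.B4Eq19LatticeOperators (Zd)
open Summit.QuantumFields.YangMills.Theorems.Prop7SPrint (basePt)
open Summit.QuantumFields.YangMills.Theorems.Prop7SectET3HilbertLetters (W₂ frobEquiv)
open Summit.QuantumFields.YangMills.Theorems.Prop7SymAvgTw (coordT3 QTw)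
open Summit.QuantumFields.YangMills.Theorems.Prop7RieszTauFrobNorm (norm_sq_frobEquiv_symm norm_le_norm_frobEquiv_symm sum_norm_sq_le_two_mul_opNorm_sq)
open Summit.QuantumFields.YangMills.Theorems.Prop7CurvedLandauRowA (exists_trueLinIter_family)
open Summit.QuantumFields.YangMills.Theorems.Prop7TrueLinCentralRegPr (trueLinIter_smul_one_eq_flat_of_regPr)
open Summit.QuantumFields.YangMills.Theorems.Prop7QTwCentralSectorRegPr (QTw_smul_one_eq_QTw_one_of_regPr)
open Summit.QuantumFields.YangMills.Theorems.Prop7TrueAvgBudgetCentral (curl_smul_one_eq divB_smul_one_eq)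
open Summit.QuantumFields.YangMills.Theorems.Prop7QTwSectors (sum_normSq_entries_sectors sum_normSq_curl_entries_sectors_member sum_normSq_divB_entries_sectors_member)
open Summit.QuantumFields.YangMills.Theorems.Prop7QTwFlatExplicit (QTw_one_apply)
open Summit.QuantumFields.YangMills.Theorems.Prop7FlatHessKOnSlice (trueLinStep_one_eq_linAvg)

/-! ## §1 Pointwise algebra in `M₂(ℂ)` -/

section Algebra

/-- **THE `M₂(ℂ)` INEQUALITY BEHIND (QB)'s FACTOR 2**: if `q = t + (l₁ + i·l₂ + l₃)` then `|q|² ≤ 2‖t‖²_F + 12(|l₁|² + |l₂|² + |l₃|²)` — operator norm ≤ Frobenius norm, the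
parallelogram law in `W₂`, and `‖·‖²_F ≤ 2|·|²` on `2×2` matrices. [cite: Balaban1985Averaging, (18)-(20) p.21; Balaban1985BackgroundPropagators, (3.11) p.392] -/
theorem norm_sq_le_of_sectors (q t l₁ l₂ l₃ : Matrix (Fin 2) (Fin 2) ℂ) (hq : q = t + (l₁ + Complex.I • l₂ + l₃)) :
    ‖q‖ ^ 2 ≤ 2 * ‖(frobEquiv.symm t : W₂)‖ ^ 2 + 12 * (‖l₁‖ ^ 2 + ‖l₂‖ ^ 2 + ‖l₃‖ ^ 2) := by
  have h0 : ‖q‖ ^ 2 ≤ ‖(frobEquiv.symm q : W₂)‖ ^ 2 := pow_le_pow_left₀ (norm_nonneg _) (norm_le_norm_frobEquiv_symm q) 2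
  have h1 : (frobEquiv.symm q : W₂) = frobEquiv.symm t + (frobEquiv.symm l₁ + Complex.I • frobEquiv.symm l₂ + frobEquiv.symm l₃) := by
    rw [hq, map_add, map_add, map_add, map_smul]
  have hI : ‖(Complex.I • frobEquiv.symm l₂ : W₂)‖ = ‖(frobEquiv.symm l₂ : W₂)‖ := by rw [norm_smul, Complex.norm_I, one_mul]
  have h2 : ‖(frobEquiv.symm q : W₂)‖ ≤ ‖(frobEquiv.symm t : W₂)‖
      + (‖(frobEquiv.symm l₁ : W₂)‖ + ‖(frobEquiv.symm l₂ : W₂)‖ + ‖(frobEquiv.symm l₃ : W₂)‖) := by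
    rw [h1]
    refine (norm_add_le _ _).trans (add_le_add le_rfl ?_)
    refine (norm_add_le _ _).trans (add_le_add ((norm_add_le _ _).trans (add_le_add le_rfl hI.le)) le_rfl)
  have h3 := norm_sq_frobEquiv_symm l₁
  have h4 := norm_sq_frobEquiv_symm l₂
  have h5 := norm_sq_frobEquiv_symm l₃
  have h6 := sum_norm_sq_le_two_mul_opNorm_sq l₁
  have h7 := sum_norm_sq_le_two_mul_opNorm_sq l₂
  have h8 := sum_norm_sq_le_two_mul_opNorm_sq l₃
  nlinarith [h0, h2, norm_nonneg (frobEquiv.symm q : W₂), norm_nonneg (frobEquiv.symm t : W₂), norm_nonneg (frobEquiv.symm l₁ : W₂),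
    norm_nonneg (frobEquiv.symm l₂ : W₂), norm_nonneg (frobEquiv.symm l₃ : W₂), norm_nonneg l₁, norm_nonneg l₂, norm_nonneg l₃,
    sq_nonneg (‖(frobEquiv.symm t : W₂)‖ - (‖(frobEquiv.symm l₁ : W₂)‖ + ‖(frobEquiv.symm l₂ : W₂)‖ + ‖(frobEquiv.symm l₃ : W₂)‖)),
    sq_nonneg (‖(frobEquiv.symm l₁ : W₂)‖ - ‖(frobEquiv.symm l₂ : W₂)‖), sq_nonneg (‖(frobEquiv.symm l₂ : W₂)‖ - ‖(frobEquiv.symm l₃ : W₂)‖),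
    sq_nonneg (‖(frobEquiv.symm l₁ : W₂)‖ - ‖(frobEquiv.symm l₃ : W₂)‖)]

/-- **THE SECTOR MASSES ARE DOMINATED BY THE TOTAL MASS**: for `𝔰𝔲(2)`-valued `a₁, a₂` and a scalar `s`, `|a₁|² + |a₂|² + |s·1|² ≤ 2|a₁ + i·a₂ + s·1|²`
(`|·|² ≤ ‖·‖²_F`, Pythagoras across the sectors ✓`sum_normSq_entries_sectors`, `‖·‖²_F ≤ 2|·|²`). [cite: Balaban1985BackgroundPropagators, (3.11) p.392; Balaban1985Averaging, (20) p.21] -/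
theorem sector_normSq_le_two_mul {a₁ a₂ : Matrix (Fin 2) (Fin 2) ℂ} (h₁ : star a₁ = -a₁ ∧ a₁.trace = 0) (h₂ : star a₂ = -a₂ ∧ a₂.trace = 0) (s : ℂ) :
    ‖a₁‖ ^ 2 + ‖a₂‖ ^ 2 + ‖s • (1 : Matrix (Fin 2) (Fin 2) ℂ)‖ ^ 2 ≤ 2 * ‖a₁ + Complex.I • a₂ + s • (1 : Matrix (Fin 2) (Fin 2) ℂ)‖ ^ 2 := by
  have hs := sum_normSq_entries_sectors h₁ h₂ s
  have e1 := MatrixNorms.opNorm_sq_le_sum_norm_sq a₁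
  have e2 := MatrixNorms.opNorm_sq_le_sum_norm_sq a₂
  have e3 := MatrixNorms.opNorm_sq_le_sum_norm_sq (s • (1 : Matrix (Fin 2) (Fin 2) ℂ))
  have e4 := sum_norm_sq_le_two_mul_opNorm_sq (a₁ + Complex.I • a₂ + s • (1 : Matrix (Fin 2) (Fin 2) ℂ))
  linarith

end Algebra

/-! ## §2 Member lemmas: the sector split of the lattice forms, the centre's forms, the centre's legs -/

section Member

variable (F : T3Family) {n K : ℕ}

/-- **CURL_HS + DIV_HS SPLITS EXACTLY ALONG THE SECTORS AT THE MEMBER** (px10 ✓`sum_normSq_curl_entries_sectors_member`∕`…divB…` summed over plaquettes∕sites).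
[cite: Balaban1985BackgroundPropagators, (3.4) p.391, (3.8) p.392, (3.11) p.392; Balaban1985Variational, (51) p.286] -/
theorem curlHS_divHS_sectors (W : GaugeField (F.P K) 0 (Matrix.specialUnitaryGroup (Fin 2) ℂ))
    (A₁ A₂ : PBond (F.P K) 0 → Matrix (Fin 2) (Fin 2) ℂ) (hA₁ : ∀ b, star (A₁ b) = -A₁ b ∧ (A₁ b).trace = 0) (hA₂ : ∀ b, star (A₂ b) = -A₂ b ∧ (A₂ b).trace = 0)
    (τ : PBond (F.P K) 0 → ℂ) :
    ((∑ x : Site (F.P K) 0, ∑ μ : Fin (F.P K).d, ∑ ν : Fin (F.P K).d,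
        (if μ < ν then ∑ j : Fin 2, ∑ k : Fin 2,
          ‖(curl (torusT (F.P K) 0) (fun κ z => unitsField (toUField W) ⟨z, κ⟩)
              (fun κ z => A₁ ⟨z, κ⟩ + Complex.I • A₂ ⟨z, κ⟩ + τ ⟨z, κ⟩ • (1 : Matrix (Fin 2) (Fin 2) ℂ)) μ ν x) j k‖ ^ 2 else 0))
      + (∑ x : Site (F.P K) 0, ∑ j : Fin 2, ∑ k : Fin 2,
        ‖(divB (torusT (F.P K) 0) (fun κ z => unitsField (toUField W) ⟨z, κ⟩)
            (fun κ z => A₁ ⟨z, κ⟩ + Complex.I • A₂ ⟨z, κ⟩ + τ ⟨z, κ⟩ • (1 : Matrix (Fin 2) (Fin 2) ℂ)) x) j k‖ ^ 2))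
      = ((∑ x : Site (F.P K) 0, ∑ μ : Fin (F.P K).d, ∑ ν : Fin (F.P K).d,
            (if μ < ν then ∑ j : Fin 2, ∑ k : Fin 2,
              ‖(curl (torusT (F.P K) 0) (fun κ z => unitsField (toUField W) ⟨z, κ⟩) (fun κ z => A₁ ⟨z, κ⟩) μ ν x) j k‖ ^ 2 else 0))
          + (∑ x : Site (F.P K) 0, ∑ j : Fin 2, ∑ k : Fin 2,
            ‖(divB (torusT (F.P K) 0) (fun κ z => unitsField (toUField W) ⟨z, κ⟩) (fun κ z => A₁ ⟨z, κ⟩) x) j k‖ ^ 2))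
        + ((∑ x : Site (F.P K) 0, ∑ μ : Fin (F.P K).d, ∑ ν : Fin (F.P K).d,
            (if μ < ν then ∑ j : Fin 2, ∑ k : Fin 2,
              ‖(curl (torusT (F.P K) 0) (fun κ z => unitsField (toUField W) ⟨z, κ⟩) (fun κ z => A₂ ⟨z, κ⟩) μ ν x) j k‖ ^ 2 else 0))
          + (∑ x : Site (F.P K) 0, ∑ j : Fin 2, ∑ k : Fin 2,
            ‖(divB (torusT (F.P K) 0) (fun κ z => unitsField (toUField W) ⟨z, κ⟩) (fun κ z => A₂ ⟨z, κ⟩) x) j k‖ ^ 2))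
        + ((∑ x : Site (F.P K) 0, ∑ μ : Fin (F.P K).d, ∑ ν : Fin (F.P K).d,
            (if μ < ν then ∑ j : Fin 2, ∑ k : Fin 2,
              ‖(curl (torusT (F.P K) 0) (fun κ z => unitsField (toUField W) ⟨z, κ⟩)
                  (fun κ z => τ ⟨z, κ⟩ • (1 : Matrix (Fin 2) (Fin 2) ℂ)) μ ν x) j k‖ ^ 2 else 0))
          + (∑ x : Site (F.P K) 0, ∑ j : Fin 2, ∑ k : Fin 2,
            ‖(divB (torusT (F.P K) 0) (fun κ z => unitsField (toUField W) ⟨z, κ⟩)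
                (fun κ z => τ ⟨z, κ⟩ • (1 : Matrix (Fin 2) (Fin 2) ℂ)) x) j k‖ ^ 2)) := by
  have hC : ∀ (x : Site (F.P K) 0) (μ ν : Fin (F.P K).d),
      (if μ < ν then ∑ j : Fin 2, ∑ k : Fin 2,
          ‖(curl (torusT (F.P K) 0) (fun κ z => unitsField (toUField W) ⟨z, κ⟩)
              (fun κ z => A₁ ⟨z, κ⟩ + Complex.I • A₂ ⟨z, κ⟩ + τ ⟨z, κ⟩ • (1 : Matrix (Fin 2) (Fin 2) ℂ)) μ ν x) j k‖ ^ 2 else 0)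
        = (if μ < ν then ∑ j : Fin 2, ∑ k : Fin 2,
              ‖(curl (torusT (F.P K) 0) (fun κ z => unitsField (toUField W) ⟨z, κ⟩) (fun κ z => A₁ ⟨z, κ⟩) μ ν x) j k‖ ^ 2 else 0)
          + (if μ < ν then ∑ j : Fin 2, ∑ k : Fin 2,
              ‖(curl (torusT (F.P K) 0) (fun κ z => unitsField (toUField W) ⟨z, κ⟩) (fun κ z => A₂ ⟨z, κ⟩) μ ν x) j k‖ ^ 2 else 0)
          + (if μ < ν then ∑ j : Fin 2, ∑ k : Fin 2,
              ‖(curl (torusT (F.P K) 0) (fun κ z => unitsField (toUField W) ⟨z, κ⟩)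
                  (fun κ z => τ ⟨z, κ⟩ • (1 : Matrix (Fin 2) (Fin 2) ℂ)) μ ν x) j k‖ ^ 2 else 0) := by
    intro x μ ν
    by_cases hμν : μ < ν
    · simp only [if_pos hμν]
      exact sum_normSq_curl_entries_sectors_member F W A₁ A₂ hA₁ hA₂ τ μ ν x
    · simp only [if_neg hμν, add_zero]
  have hD : ∀ x : Site (F.P K) 0,
      (∑ j : Fin 2, ∑ k : Fin 2, ‖(divB (torusT (F.P K) 0) (fun κ z => unitsField (toUField W) ⟨z, κ⟩)
          (fun κ z => A₁ ⟨z, κ⟩ + Complex.I • A₂ ⟨z, κ⟩ + τ ⟨z, κ⟩ • (1 : Matrix (Fin 2) (Fin 2) ℂ)) x) j k‖ ^ 2)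
        = (∑ j : Fin 2, ∑ k : Fin 2, ‖(divB (torusT (F.P K) 0) (fun κ z => unitsField (toUField W) ⟨z, κ⟩) (fun κ z => A₁ ⟨z, κ⟩) x) j k‖ ^ 2)
          + (∑ j : Fin 2, ∑ k : Fin 2, ‖(divB (torusT (F.P K) 0) (fun κ z => unitsField (toUField W) ⟨z, κ⟩) (fun κ z => A₂ ⟨z, κ⟩) x) j k‖ ^ 2)
          + ∑ j : Fin 2, ∑ k : Fin 2, ‖(divB (torusT (F.P K) 0) (fun κ z => unitsField (toUField W) ⟨z, κ⟩)
              (fun κ z => τ ⟨z, κ⟩ • (1 : Matrix (Fin 2) (Fin 2) ℂ)) x) j k‖ ^ 2 :=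
    fun x => sum_normSq_divB_entries_sectors_member F W A₁ A₂ hA₁ hA₂ τ x
  simp only [hC, hD, Finset.sum_add_distrib]
  ring

/-- **THE CENTRE'S LATTICE FORMS DO NOT SEE THE BACKGROUND**: `CURL_HS(W, τ·1) + DIV_HS(W, τ·1) = CURL_HS(1, τ·1) + DIV_HS(1, τ·1)` (px10 ✓`curl_smul_one_eq`∕`divB_smul_one_eq`).
[cite: Balaban1985BackgroundPropagators, (3.4) p.391, (3.8) p.392] -/
theorem curlHS_divHS_smul_one_bg (W : GaugeField (F.P K) 0 (Matrix.specialUnitaryGroup (Fin 2) ℂ)) (τ : PBond (F.P K) 0 → ℂ) :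
    ((∑ x : Site (F.P K) 0, ∑ μ : Fin (F.P K).d, ∑ ν : Fin (F.P K).d,
        (if μ < ν then ∑ j : Fin 2, ∑ k : Fin 2,
          ‖(curl (torusT (F.P K) 0) (fun κ z => unitsField (toUField W) ⟨z, κ⟩)
              (fun κ z => τ ⟨z, κ⟩ • (1 : Matrix (Fin 2) (Fin 2) ℂ)) μ ν x) j k‖ ^ 2 else 0))
      + (∑ x : Site (F.P K) 0, ∑ j : Fin 2, ∑ k : Fin 2,
        ‖(divB (torusT (F.P K) 0) (fun κ z => unitsField (toUField W) ⟨z, κ⟩)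
            (fun κ z => τ ⟨z, κ⟩ • (1 : Matrix (Fin 2) (Fin 2) ℂ)) x) j k‖ ^ 2))
      = ((∑ x : Site (F.P K) 0, ∑ μ : Fin (F.P K).d, ∑ ν : Fin (F.P K).d,
          (if μ < ν then ∑ j : Fin 2, ∑ k : Fin 2,
            ‖(curl (torusT (F.P K) 0) (fun κ z => unitsField (toUField (1 : GaugeField (F.P K) 0 (Matrix.specialUnitaryGroup (Fin 2) ℂ))) ⟨z, κ⟩)
                (fun κ z => τ ⟨z, κ⟩ • (1 : Matrix (Fin 2) (Fin 2) ℂ)) μ ν x) j k‖ ^ 2 else 0))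
        + (∑ x : Site (F.P K) 0, ∑ j : Fin 2, ∑ k : Fin 2,
          ‖(divB (torusT (F.P K) 0) (fun κ z => unitsField (toUField (1 : GaugeField (F.P K) 0 (Matrix.specialUnitaryGroup (Fin 2) ℂ))) ⟨z, κ⟩)
              (fun κ z => τ ⟨z, κ⟩ • (1 : Matrix (Fin 2) (Fin 2) ℂ)) x) j k‖ ^ 2)) := by
  have hC : ∀ (μ ν : Fin (F.P K).d) (x : Site (F.P K) 0),
      curl (torusT (F.P K) 0) (fun κ z => unitsField (toUField W) ⟨z, κ⟩) (fun κ z => τ ⟨z, κ⟩ • (1 : Matrix (Fin 2) (Fin 2) ℂ)) μ ν x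
        = curl (torusT (F.P K) 0) (fun κ z => unitsField (toUField (1 : GaugeField (F.P K) 0 (Matrix.specialUnitaryGroup (Fin 2) ℂ))) ⟨z, κ⟩)
            (fun κ z => τ ⟨z, κ⟩ • (1 : Matrix (Fin 2) (Fin 2) ℂ)) μ ν x := fun μ ν x =>
    curl_smul_one_eq (torusT (F.P K) 0) _ _ (fun κ z => τ ⟨z, κ⟩) μ ν x
  have hD : ∀ x : Site (F.P K) 0,
      divB (torusT (F.P K) 0) (fun κ z => unitsField (toUField W) ⟨z, κ⟩) (fun κ z => τ ⟨z, κ⟩ • (1 : Matrix (Fin 2) (Fin 2) ℂ)) x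
        = divB (torusT (F.P K) 0) (fun κ z => unitsField (toUField (1 : GaugeField (F.P K) 0 (Matrix.specialUnitaryGroup (Fin 2) ℂ))) ⟨z, κ⟩)
            (fun κ z => τ ⟨z, κ⟩ • (1 : Matrix (Fin 2) (Fin 2) ℂ)) x := fun x =>
    divB_smul_one_eq (torusT (F.P K) 0) _ _ (fun κ z => τ ⟨z, κ⟩) x
  simp only [hC, hD]

/-- ★ **THE CENTRE'S LEGS ARE THE FLAT LEGS**: at `W ∈ RegPr F n K e` (`0 < e`, `10⁷L³e ≤ 1`), for the E′ recursion family `Q` along `W̄^{(·)}` and every scalar field `τ`,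
`Q (K−n) (τ·1) ĉ = QTw W (τ·1) c + (r₁(τ·1)(ŷ(c₋)) − r₁(τ·1)(ŷ(c₊)))` with `r₁` the FLAT comb-frame response (px19 g6 ✓`rlegs_flat`'s letters) — px10 ✓(7)∕✓`QTw_smul_one_eq_QTw_one_of_regPr` ∘ px21
✓`QTw_one_apply` at the flat `linAvg` tower (✓`exists_trueLinIter_family 1` ∘ ✓`trueLinStep_one_eq_linAvg`). [cite: Balaban1985BackgroundPropagators, (3.13)-(3.15) p.393; Balaban1985Averaging, (125)-(127) pp.36-37, (160) p.42] -/
theorem central_legs_identity_of_regPr (hnK : n < K) {e : ℝ} (he : 0 < e) (hε : 10 ^ 7 * (F.L : ℝ) ^ 3 * e ≤ 1)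
    (W : GaugeField (F.P K) 0 (Matrix.specialUnitaryGroup (Fin 2) ℂ)) (hreg : RegPr F n K e W)
    (Q : (k : ℕ) → (PBond (F.P K) 0 → Matrix (Fin 2) (Fin 2) ℂ) → PBond (F.P K) k → Matrix (Fin 2) (Fin 2) ℂ) (hQ0 : ∀ Y, Q 0 Y = Y)
    (hQs : ∀ (k : ℕ) (Y : PBond (F.P K) 0 → Matrix (Fin 2) (Fin 2) ℂ) (c : PBond (F.P K) (k + 1)), Q (k + 1) Y c
      = (fderiv ℂ (eml : (Idx (F.P K) → Matrix (Fin 2) (Fin 2) ℂ) → Matrix (Fin 2) (Fin 2) ℂ)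
            (fun i => ((loopHol (Averaging.iter (fun i => blockAvg (P := (F.P K)) (j := i) (expMeanLogSU (n := Fin 2))) k W) c i : Matrix.specialUnitaryGroup (Fin 2) ℂ) : Matrix (Fin 2) (Fin 2) ℂ))
            (fun i => covWalkSum (Averaging.iter (fun i => blockAvg (P := (F.P K)) (j := i) (expMeanLogSU (n := Fin 2))) k W) (Q k Y) (walk (emb c.src) (loopWord (F.P K).L c.dir (off i.1) i.2.1 i.2.2))
              * ((loopHol (Averaging.iter (fun i => blockAvg (P := (F.P K)) (j := i) (expMeanLogSU (n := Fin 2))) k W) c i : Matrix.specialUnitaryGroup (Fin 2) ℂ) : Matrix (Fin 2) (Fin 2) ℂ))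
            * star ((corr (expMeanLogSU (n := Fin 2)) (Averaging.iter (fun i => blockAvg (P := (F.P K)) (j := i) (expMeanLogSU (n := Fin 2))) k W) c : Matrix.specialUnitaryGroup (Fin 2) ℂ) : Matrix (Fin 2) (Fin 2) ℂ)
          + ((corr (expMeanLogSU (n := Fin 2)) (Averaging.iter (fun i => blockAvg (P := (F.P K)) (j := i) (expMeanLogSU (n := Fin 2))) k W) c : Matrix.specialUnitaryGroup (Fin 2) ℂ) : Matrix (Fin 2) (Fin 2) ℂ)
            * covWalkSum (Averaging.iter (fun i => blockAvg (P := (F.P K)) (j := i) (expMeanLogSU (n := Fin 2))) k W) (Q k Y) (walk (emb c.src) (List.replicate (F.P K).L (c.dir, true)))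
            * star ((corr (expMeanLogSU (n := Fin 2)) (Averaging.iter (fun i => blockAvg (P := (F.P K)) (j := i) (expMeanLogSU (n := Fin 2))) k W) c : Matrix.specialUnitaryGroup (Fin 2) ℂ) : Matrix (Fin 2) (Fin 2) ℂ)))
    (τ : PBond (F.P K) 0 → ℂ) (c : PBond (F.P n) 0) :
    Q (K - n) (fun b => τ b • (1 : Matrix (Fin 2) (Fin 2) ℂ)) (bondShift (sites_eq F n K hnK.le) c)
      = QTw F n K hnK.le W (fun b => τ b • (1 : Matrix (Fin 2) (Fin 2) ℂ)) c
        + ((∑ j ∈ Finset.range (K - n), Fhat (F.P K).L (linQIter (F.P K).L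
              (fun (z : Zd 3) (κ : Fin 3) => τ ⟨transl (basePt F n K) z, κ⟩ • (1 : Matrix (Fin 2) (Fin 2) ℂ)) j)
              ((((F.P K).L : ℤ) ^ (K - n - j)) • (fun i : Fin 3 => coordT3 F n K hnK.le c.src i)))
          - (∑ j ∈ Finset.range (K - n), Fhat (F.P K).L (linQIter (F.P K).L
              (fun (z : Zd 3) (κ : Fin 3) => τ ⟨transl (basePt F n K) z, κ⟩ • (1 : Matrix (Fin 2) (Fin 2) ℂ)) j)
              ((((F.P K).L : ℤ) ^ (K - n - j)) • (fun i : Fin 3 => coordT3 F n K hnK.le c.tgt i)))) := by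
  obtain ⟨Q₁, hQ0₁, hQs₁⟩ := exists_trueLinIter_family (N := 2) (1 : GaugeField (F.P K) 0 (Matrix.specialUnitaryGroup (Fin 2) ℂ))
  have hQs₁' : ∀ (i : ℕ) (Y : PBond (F.P K) 0 → Matrix (Fin 2) (Fin 2) ℂ) (c : PBond (F.P K) (i + 1)),
      Q₁ (i + 1) Y c = linAvg (Q₁ i Y) c := fun i Y c =>
    (hQs₁ i Y c).trans (trueLinStep_one_eq_linAvg i (Q₁ i Y) c)
  have hflat := (trueLinIter_smul_one_eq_flat_of_regPr F he hε W hreg Q Q₁ hQ0 hQs hQ0₁ hQs₁ le_rfl τ).1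
  rw [hflat, QTw_smul_one_eq_QTw_one_of_regPr F hnK.le he hε W hreg τ,
    QTw_one_apply F hnK.le Q₁ hQ0₁ hQs₁' (fun b => τ b • (1 : Matrix (Fin 2) (Fin 2) ℂ)) c]
  exact (sub_add_cancel _ _).symm

end Member

end Summit.QuantumFields.YangMills.Theorems.Prop7TrueAvgBudgetSectorLetters

end
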